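/-
Origin: expansion seat `planner-pub-hodgecm-pv10-0`, handover 2026-08-18 (`HOME/pub-hodgecm-pv10/lean/Pv10/NormOneTorus.lean`, md5 0df403de, 171 lines);
landed by the gen-6 packager in gate run 22 as `HodgeCM/PerL34/NormOneTorus.lean` (import ^import Pv[0-9]+\.→import HodgeCM.PerL34. ×2).
-/
/-
Origin: planner-pub-hodgecm-pv10-0 (unit pub-hodgecm-pv10), HodgeCM publication cell, 2026-08-18.
Node N15 (PerL v5 §3.2, tex ll. 309–313), the COMPACT factor of `B`: the norm-one torus
`T = ∏_v {‖u_v‖ = 1} ⊂ K_∞^×` is a compact subgroup, and the closedness / continuity criterion of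
`ProperImage` instantiated over Mathlib's idele class group `C_K` with this torus.  KERNEL.
At landing `Pv10.InfinityType` → `HodgeCM.PerL34.InfinityType`, `Pv10.ProperImage` →
`HodgeCM.PerL34.ProperImage`.
-/
import Summits.HodgeConjecture.HodgeCM.PerL34.InfinityType
import Summits.HodgeConjecture.HodgeCM.PerL34.ProperImage
import Mathlib.Topology.MetricSpace.ProperSpace
import Mathlib.Analysis.Normed.Group.Uniform

/-!
# The norm-one torus of `K_∞^×` (node N15, compact factor of `B`)

* `NumberField.InfiniteAdeleRing.normOneTorus K : Subgroup (InfiniteAdeleRing K)ˣ` — the ideles at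
  infinity all of whose components have norm one (`≅ ∏_{v real} {±1} × ∏_{v complex} S¹`);
* `NumberField.InfiniteAdeleRing.isCompact_normOneTorus` / the `CompactSpace` instance;
* `NumberField.isClosed_range_sup_torusToClass`: for ANY proper continuous homomorphism
  `f : A →* C_K` (PerL: `C_{L₀} → C_L`), the subgroup `f.range ⊔ [T]` of `C_K` is closed, and
  `NumberField.continuous_char_range_sup_torus_iff`: a character of it is continuous iff its
  pullbacks to `A` and to `T` are (PerL ll. 309–313 with the compact factor made explicit; the
  proper factor `C_{L₀} → C_L` needs adelic base change, absent from Mathlib, and stays abstract).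
-/

set_option autoImplicit false

noncomputable section

open Topology

namespace NumberField

open InfinitePlace InfinitePlace.Completion

variable (K : Type*) [Field K]

namespace InfiniteAdeleRing

/-- The unit sphere of the completion at an infinite place is compact (closed embedding into `ℂ`). -/
theorem isCompact_sphere_completion (v : InfinitePlace K) :
    IsCompact (Metric.sphere (0 : v.Completion) 1) := by
  have hφ : Isometry (extensionEmbedding v) := isometry_extensionEmbedding v
  have hce : IsClosedEmbedding (extensionEmbedding v) := hφ.isClosedEmbedding
  have hset : Metric.sphere (0 : v.Completion) 1 = extensionEmbedding v ⁻¹' Metric.sphere (0 : ℂ) 1 := by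
    ext x
    simp only [Set.mem_preimage, mem_sphere_zero_iff_norm]
    rw [hφ.norm_map_of_map_zero (map_zero _)]
  rw [hset]
  exact hce.isCompact_preimage (isCompact_sphere 0 1)

/-- (Ported verbatim from the HodgeCMPerL package; no docstring in the source.) -/
instance compactSpace_sphere_completion (v : InfinitePlace K) :
    CompactSpace (Metric.sphere (0 : v.Completion) 1) :=
  isCompact_iff_compactSpace.mp (isCompact_sphere_completion K v)

/-- Components of a unit of `K_∞` are nonzero. -/
theorem apply_ne_zero (u : (InfiniteAdeleRing K)ˣ) (v : InfinitePlace K) :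
    (u : InfiniteAdeleRing K) v ≠ 0 :=
  (Units.map (evalRingHom K v).toMonoidHom u).ne_zero

/-- (Ported verbatim from the HodgeCMPerL package; no docstring in the source.) -/
theorem inv_apply (u : (InfiniteAdeleRing K)ˣ) (v : InfinitePlace K) :
    (↑u⁻¹ : InfiniteAdeleRing K) v = ((u : InfiniteAdeleRing K) v)⁻¹ := by
  have h : (↑u⁻¹ : InfiniteAdeleRing K) v * (u : InfiniteAdeleRing K) v = 1 :=
    congrArg (fun x : InfiniteAdeleRing K => x v) u.inv_mul
  exact eq_inv_of_mul_eq_one_left h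

/-- **The norm-one torus** `T = {u ∈ K_∞^× | ‖u_v‖ = 1 for all v}`. -/
def normOneTorus : Subgroup (InfiniteAdeleRing K)ˣ where
  carrier := {u | ∀ v : InfinitePlace K, ‖(u : InfiniteAdeleRing K) v‖ = 1}
  mul_mem' {a b} ha hb v := by
    have h : ((a * b : (InfiniteAdeleRing K)ˣ) : InfiniteAdeleRing K) v =
        (a : InfiniteAdeleRing K) v * (b : InfiniteAdeleRing K) v := rfl
    rw [Set.mem_setOf_eq] at ha hb
    rw [h, norm_mul, ha v, hb v, one_mul]
  one_mem' v := by
    have h : ((1 : (InfiniteAdeleRing K)ˣ) : InfiniteAdeleRing K) v = 1 := rfl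
    rw [h, norm_one]
  inv_mem' {a} ha v := by
    rw [Set.mem_setOf_eq] at ha
    rw [inv_apply, norm_inv, ha v, inv_one]

/-- (Ported verbatim from the HodgeCMPerL package; no docstring in the source.) -/
theorem mem_normOneTorus (u : (InfiniteAdeleRing K)ˣ) :
    u ∈ normOneTorus K ↔ ∀ v : InfinitePlace K, ‖(u : InfiniteAdeleRing K) v‖ = 1 :=
  Iff.rfl

/-- Parametrisation of the torus by the product of the unit spheres. -/
def torusParam (s : ∀ v : InfinitePlace K, Metric.sphere (0 : v.Completion) 1) :
    (InfiniteAdeleRing K)ˣ where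
  val := fun v => (s v : v.Completion)
  inv := fun v => ((s v : v.Completion))⁻¹
  val_inv := by
    funext v
    exact mul_inv_cancel₀ (ne_zero_of_mem_unit_sphere (s v))
  inv_val := by
    funext v
    exact inv_mul_cancel₀ (ne_zero_of_mem_unit_sphere (s v))

/-- (Ported verbatim from the HodgeCMPerL package; no docstring in the source.) -/
@[simp] theorem torusParam_apply (s : ∀ v : InfinitePlace K, Metric.sphere (0 : v.Completion) 1)
    (v : InfinitePlace K) : (torusParam K s : InfiniteAdeleRing K) v = s v := rfl

/-- (Ported verbatim from the HodgeCMPerL package; no docstring in the source.) -/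
theorem continuous_torusParam : Continuous (torusParam K) := by
  rw [Units.continuous_iff]
  constructor
  · exact continuous_pi fun v => continuous_subtype_val.comp (continuous_apply v)
  · show Continuous fun s : (∀ v : InfinitePlace K, Metric.sphere (0 : v.Completion) 1) =>
      fun v => ((s v : v.Completion))⁻¹
    exact continuous_pi fun v =>
      (continuous_subtype_val.comp (continuous_apply v)).inv₀
        fun s => ne_zero_of_mem_unit_sphere (s v)

/-- (Ported verbatim from the HodgeCMPerL package; no docstring in the source.) -/
theorem range_torusParam : Set.range (torusParam K) = (normOneTorus K : Set (InfiniteAdeleRing K)ˣ) := by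
  ext u
  constructor
  · rintro ⟨s, rfl⟩ v
    rw [torusParam_apply]
    exact norm_eq_of_mem_sphere (s v)
  · intro hu
    exact ⟨fun v => ⟨(u : InfiniteAdeleRing K) v, mem_sphere_zero_iff_norm.mpr (hu v)⟩,
      Units.ext rfl⟩

/-- **`T` is compact.** -/
theorem isCompact_normOneTorus : IsCompact (normOneTorus K : Set (InfiniteAdeleRing K)ˣ) := by
  rw [← range_torusParam]
  exact isCompact_range (continuous_torusParam K)

/-- (Ported verbatim from the HodgeCMPerL package; no docstring in the source.) -/
instance compactSpace_normOneTorus : CompactSpace (normOneTorus K) :=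
  isCompact_iff_compactSpace.mp (isCompact_normOneTorus K)

end InfiniteAdeleRing

open InfiniteAdeleRing

variable [NumberField K]

/-- The torus mapped to the idele class group: `T →* C_K`. -/
def torusToClass : normOneTorus K →* IdeleClassGroup K :=
  (infUnitsToClass K).comp (normOneTorus K).subtype

/-- (Ported verbatim from the HodgeCMPerL package; no docstring in the source.) -/
theorem torusToClass_apply (t : normOneTorus K) :
    torusToClass K t = infUnitsToClass K (t : (InfiniteAdeleRing K)ˣ) := rfl

/-- (Ported verbatim from the HodgeCMPerL package; no docstring in the source.) -/
theorem continuous_torusToClass : Continuous (torusToClass K) :=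
  (continuous_infUnitsToClass K).comp continuous_subtype_val

/-- **PerL l. 309, GL₁/K shape: `f.range ⊔ [T]` is closed in `C_K`** for every PROPER continuous
homomorphism `f : A →* C_K` (PerL: the map `C_{L₀} → C_L`). -/
theorem isClosed_range_sup_torusToClass {A : Type*} [Group A] [TopologicalSpace A]
    (f : A →* IdeleClassGroup K) (hf : IsProperMap f) :
    IsClosed ((f.range ⊔ (torusToClass K).range : Subgroup (IdeleClassGroup K)) :
      Set (IdeleClassGroup K)) := by
  -- `have`/`exact` (rather than a direct term) keeps the instance unification cheap
  have h := MonoidHom.isClosed_range_sup_range (C := IdeleClassGroup K) f (torusToClass K) hf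
    (continuous_torusToClass K)
  exact h

/-- **PerL ll. 309–313, GL₁/K shape:** a character of `f.range ⊔ [T]` is continuous iff its pullbacks
to `A` and to the torus `T` are. -/
theorem continuous_char_range_sup_torus_iff {A : Type*} [Group A] [TopologicalSpace A]
    (f : A →* IdeleClassGroup K) (hf : IsProperMap f)
    (χ : (f.range ⊔ (torusToClass K).range : Subgroup (IdeleClassGroup K)) →* Circle) :
    Continuous χ ↔
      Continuous (fun a : A => χ ⟨f a, Subgroup.mem_sup_left ⟨a, rfl⟩⟩) ∧
      Continuous (fun t : normOneTorus K => χ ⟨torusToClass K t, Subgroup.mem_sup_right ⟨t, rfl⟩⟩) := by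
  have h := MonoidHom.continuous_char_sup_range_iff (C := IdeleClassGroup K) f (torusToClass K) hf
    (continuous_torusToClass K) χ
  exact h

end NumberField

end
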